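import Literature.Geometry.Manifold.ProperFunctionTube
import Mathlib.Analysis.SpecialFunctions.SmoothTransition
import HarnessLib

/-!
# Untwisting a tube along a neck with the same slices

General differential topology (topic `Geometry/Manifold`; everything PROVED, no definitions, no
named facts). Two smooth embeddings `ι, ψ : F × ℝ ↪ M` of a cylinder which have **the same
slices** on a bottom segment — `ι(F × {t}) = ψ(F × {t + d})` for `t ≤ a + 1` — differ there by a
**fibrewise twist**: `ι(ν_t(θ), t) = ψ(θ, t + d)` for the diffeomorphisms
`ν_t = pr₁ ∘ ι⁻¹ ∘ ψ(·, t + d)` of `F`. Freezing the twist above the level `a`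
(`ν_{λ(t)}`, `λ(t) = t` for `t ≤ a`, `λ` constant `= a` for `t ≥ a + 1`) and reparametrising `ι`
by `Θ(θ, t) = (ν_{λ(t)}(θ), t)` — a diffeomorphism of `F × ℝ` over `ℝ`, with inverse
`(θ', t) ↦ (pr₁ ψ⁻¹ ι(θ', λ t), t)` — gives a smooth embedding `ι' = ι ∘ Θ` with the same range
and the same slices as `ι` which AGREES POINTWISE with `ψ(·, · + d)` below the level `a`
(`exists_untwist`). This is the (metric-free) device by which a tube recognised from a height
function (`Literature.Geometry.Manifold.exists_isSmoothEmbedding_of_heightFunction`, whose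
parametrisation of the slices is that of an auxiliary flow) is matched pointwise to a given
neck — e.g. to the polar coordinates of a cap, so that cap and tube glue to one smooth embedding
of a ball (the collared ball pieces of a surgically modified Ricci flow,
`Literature.Geometry.Riemannian.IsBallPiece`; R. Hamilton, Comm. Anal. Geom. 5 (1997), §C2, p. 31,
normal forms of overlapping necks "unique up to a rigid motion"; here no rigidity is used, only
equality of slices). Standard differential topology (cf. M. W. Hirsch, *Differential Topology*
(1976), Ch. 6 §2, level-preserving diffeomorphisms, and Ch. 8 §1, isotopies as level-preserving
maps `F × ℝ → F × ℝ`).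

## References

* M. W. Hirsch, *Differential Topology*, GTM 33 (1976), Ch. 6 §2 and Ch. 8 §1. [HirschDT1976]
* R. S. Hamilton, *Four-manifolds with positive isotropic curvature*, Comm. Anal. Geom. 5 (1997),
  §C2, p. 31. [Hamilton1997]
-/

open scoped Manifold ContDiff Topology
open Set Function Filter Topology

noncomputable section

namespace Literature.Geometry.Manifold

universe u

/-! ### The freezing function -/

section Freeze

/-- **Freezing a parameter above a level**: `λ(t) = t - (t - a) S(t - a)` (`S` the smooth
transition) is smooth, equals `t` for `t ≤ a`, and takes values in `(-∞, a + 1]`; indeed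
`λ(t) ≤ a + 1` always and `λ(t) = a` for `t ≥ a + 1`. [folklore] -/
theorem freeze_props (a : ℝ) :
    ContDiff ℝ ∞ (fun t ↦ t - (t - a) * Real.smoothTransition (t - a)) ∧
    (∀ t ≤ a, t - (t - a) * Real.smoothTransition (t - a) = t) ∧
    (∀ t, t - (t - a) * Real.smoothTransition (t - a) ≤ a + 1) := by
  refine ⟨contDiff_id.sub ((contDiff_id.sub contDiff_const).mul
      (Real.smoothTransition.contDiff.comp (contDiff_id.sub contDiff_const))),
    fun t ht ↦ ?_, fun t ↦ ?_⟩
  · rw [Real.smoothTransition.zero_of_nonpos (by linarith)]; ring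
  · rcases le_or_gt t a with h | h
    · rw [Real.smoothTransition.zero_of_nonpos (by linarith)]; linarith
    · rcases le_or_gt (t - a) 1 with h1 | h1
      · have h0 : 0 ≤ (t - a) * Real.smoothTransition (t - a) :=
          mul_nonneg (by linarith) (Real.smoothTransition.nonneg _)
        linarith
      · rw [Real.smoothTransition.one_of_one_le h1.le]; linarith

end Freeze

/-! ### Untwisting -/

section Untwist

variable {E : Type u} [NormedAddCommGroup E] [NormedSpace ℝ E]
  {H : Type*} [TopologicalSpace H] {I : ModelWithCorners ℝ E H} [I.Boundaryless]
  {M : Type*} [TopologicalSpace M] [ChartedSpace H M] [IsManifold I ∞ M]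
  {EF : Type*} [NormedAddCommGroup EF] [NormedSpace ℝ EF] {HF : Type*} [TopologicalSpace HF]
  {IF : ModelWithCorners ℝ EF HF} [IF.Boundaryless]
  {F : Type*} [TopologicalSpace F] [ChartedSpace HF F] [IsManifold IF ∞ F] [Nonempty F]

/-- **Untwisting a tube along a neck with the same slices.** Let `ι, ψ : F × ℝ ↪ M` be smooth
embeddings of the cylinder over `F` (boundaryless models, `L : E_F × ℝ ≃ E`), `ι` with open
range, having the same slices on a bottom segment: `ι(F × {t}) = ψ(F × {t + d})` for all
`t ≤ a + 1`. Then there is a smooth embedding `ι' : F × ℝ ↪ M` with `range ι' = range ι`, with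
the same slices `ι'(F × {t}) = ι(F × {t})` for every `t`, and with `ι'(θ, t) = ψ(θ, t + d)` for
`t ≤ a` — namely `ι' = ι ∘ Θ`, `Θ(θ, t) = (pr₁ ι⁻¹ ψ(θ, λ(t) + d), t)` with the frozen parameter
`λ` of `freeze_props`. [cite: HirschDT1976, Ch. 8 §1] -/
theorem exists_untwist {ι ψ : F × ℝ → M}
    (hι : Manifold.IsSmoothEmbedding (IF.prod 𝓘(ℝ, ℝ)) I ∞ ι) (hιo : IsOpen (range ι))
    (hψ : Manifold.IsSmoothEmbedding (IF.prod 𝓘(ℝ, ℝ)) I ∞ ψ) (L : (EF × ℝ) ≃L[ℝ] E) {a d : ℝ}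
    (hslice : ∀ t ≤ a + 1, ι '' (univ ×ˢ {t}) = ψ '' (univ ×ˢ {t + d})) :
    ∃ ι' : F × ℝ → M, Manifold.IsSmoothEmbedding (IF.prod 𝓘(ℝ, ℝ)) I ∞ ι' ∧
      range ι' = range ι ∧ (∀ t : ℝ, ι' '' (univ ×ˢ {t}) = ι '' (univ ×ˢ {t})) ∧
      ∀ (θ : F) (t : ℝ), t ≤ a → ι' (θ, t) = ψ (θ, t + d) := by
  classical
  obtain ⟨hLs, hLa, hLle⟩ := freeze_props a
  set lam : ℝ → ℝ := fun t ↦ t - (t - a) * Real.smoothTransition (t - a) with hlam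
  have hιinj : Injective ι := hι.isEmbedding.injective
  have hψinj : Injective ψ := hψ.isEmbedding.injective
  have hιinv : ∀ p, invFun ι (ι p) = p := leftInverse_invFun hιinj
  have hψinv : ∀ p, invFun ψ (ψ p) = p := leftInverse_invFun hψinj
  -- the slice correspondences
  have hψι : ∀ (θ : F) (t : ℝ), t ≤ a + 1 → ∃ θ', ι (θ', t) = ψ (θ, t + d) := by
    intro θ t ht
    have : ψ (θ, t + d) ∈ ι '' (univ ×ˢ {t}) := by
      rw [hslice t ht]; exact ⟨(θ, t + d), ⟨mem_univ _, rfl⟩, rfl⟩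
    obtain ⟨⟨θ', t'⟩, ⟨-, rfl : t' = t⟩, h⟩ := this
    exact ⟨θ', h⟩
  have hιψ : ∀ (θ' : F) (t : ℝ), t ≤ a + 1 → ∃ θ, ψ (θ, t + d) = ι (θ', t) := by
    intro θ' t ht
    have : ι (θ', t) ∈ ψ '' (univ ×ˢ {t + d}) := by
      rw [← hslice t ht]; exact ⟨(θ', t), ⟨mem_univ _, rfl⟩, rfl⟩
    obtain ⟨⟨θ, t'⟩, ⟨-, rfl : t' = t + d⟩, h⟩ := this
    exact ⟨θ, h⟩
  -- the twist and its inverse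
  set ν : F × ℝ → F := fun q ↦ (invFun ι (ψ (q.1, lam q.2 + d))).1 with hν
  set om : F × ℝ → F := fun q ↦ (invFun ψ (ι (q.1, lam q.2))).1 with hom
  have hν_spec : ∀ (θ : F) (t : ℝ), ι (ν (θ, t), lam t) = ψ (θ, lam t + d) := by
    intro θ t
    obtain ⟨θ', h⟩ := hψι θ (lam t) (hLle t)
    have : ν (θ, t) = θ' := by
      show (invFun ι (ψ (θ, lam t + d))).1 = θ'
      rw [← h, hιinv]
    rw [this, h]
  have hom_spec : ∀ (θ' : F) (t : ℝ), ψ (om (θ', t), lam t + d) = ι (θ', lam t) := by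
    intro θ' t
    obtain ⟨θ, h⟩ := hιψ θ' (lam t) (hLle t)
    have : om (θ', t) = θ := by
      show (invFun ψ (ι (θ', lam t))).1 = θ
      rw [← h, hψinv]
    rw [this, h]
  have homν : ∀ (θ : F) (t : ℝ), om (ν (θ, t), t) = θ := by
    intro θ t
    show (invFun ψ (ι (ν (θ, t), lam t))).1 = θ
    rw [hν_spec, hψinv]
  have hνom : ∀ (θ' : F) (t : ℝ), ν (om (θ', t), t) = θ' := by
    intro θ' t
    show (invFun ι (ψ (om (θ', t), lam t + d))).1 = θ'
    rw [hom_spec, hιinv]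
  -- smoothness of the twist and of its inverse
  have hlam_s : ContMDiff 𝓘(ℝ, ℝ) 𝓘(ℝ, ℝ) ∞ lam := hLs.contMDiff
  have hνs : ContMDiff (IF.prod 𝓘(ℝ, ℝ)) IF ∞ ν := by
    have h1 : ContMDiff (IF.prod 𝓘(ℝ, ℝ)) I ∞ fun q : F × ℝ ↦ ψ (q.1, lam q.2 + d) :=
      hψ.contMDiff.comp (contMDiff_fst.prodMk
        (((contDiff_id.add contDiff_const).comp_contMDiff (hlam_s.comp contMDiff_snd))))
    have h2 : ContMDiffOn I IF ∞ (fun y ↦ (invFun ι y).1) (range ι) :=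
      contMDiff_fst.comp_contMDiffOn (contMDiffOn_invFun_range hι)
    refine h2.comp_contMDiff h1 fun q ↦ ?_
    obtain ⟨θ', h⟩ := hψι q.1 (lam q.2) (hLle q.2)
    exact ⟨(θ', lam q.2), h⟩
  have homs : ContMDiff (IF.prod 𝓘(ℝ, ℝ)) IF ∞ om := by
    have h1 : ContMDiff (IF.prod 𝓘(ℝ, ℝ)) I ∞ fun q : F × ℝ ↦ ι (q.1, lam q.2) :=
      hι.contMDiff.comp (contMDiff_fst.prodMk (hlam_s.comp contMDiff_snd))
    have h2 : ContMDiffOn I IF ∞ (fun y ↦ (invFun ψ y).1) (range ψ) :=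
      contMDiff_fst.comp_contMDiffOn (contMDiffOn_invFun_range hψ)
    refine h2.comp_contMDiff h1 fun q ↦ ?_
    obtain ⟨θ, h⟩ := hιψ q.1 (lam q.2) (hLle q.2)
    exact ⟨(θ, lam q.2 + d), h⟩
  -- the diffeomorphism `Θ` of the cylinder over `ℝ`
  let Θ : Diffeomorph (IF.prod 𝓘(ℝ, ℝ)) (IF.prod 𝓘(ℝ, ℝ)) (F × ℝ) (F × ℝ) ∞ :=
    { toFun := fun q ↦ (ν q, q.2)
      invFun := fun q ↦ (om q, q.2)
      left_inv := fun q ↦ Prod.ext (homν q.1 q.2) rfl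
      right_inv := fun q ↦ Prod.ext (hνom q.1 q.2) rfl
      contMDiff_toFun := hνs.prodMk contMDiff_snd
      contMDiff_invFun := homs.prodMk contMDiff_snd }
  have hΘ : ∀ q : F × ℝ, Θ q = (ν q, q.2) := fun q ↦ rfl
  have hΘsymm : ∀ q : F × ℝ, Θ.symm q = (om q, q.2) := fun q ↦ rfl
  -- the untwisted tube
  set ι' : F × ℝ → M := ι ∘ Θ with hι'
  have hι's : ContMDiff (IF.prod 𝓘(ℝ, ℝ)) I ∞ ι' := hι.contMDiff.comp Θ.contMDiff
  have hrange : range ι' = range ι := by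
    have hΘr : range (Θ : F × ℝ → F × ℝ) = univ :=
      range_eq_univ.2 fun q ↦ ⟨Θ.symm q, Θ.apply_symm_apply q⟩
    rw [hι', range_comp, hΘr, image_univ]
  have hι'o : IsOpenEmbedding ι' :=
    (⟨hι.isEmbedding, hιo⟩ : IsOpenEmbedding ι).comp Θ.toHomeomorph.isOpenEmbedding
  -- smoothness of the inverse on the range
  set κ : M → F × ℝ := Θ.symm ∘ invFun ι with hκ
  have hκs : ContMDiffOn I (IF.prod 𝓘(ℝ, ℝ)) ∞ κ (range ι) :=
    Θ.symm.contMDiff.comp_contMDiffOn (contMDiffOn_invFun_range hι)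
  set P := hι'o.toOpenPartialHomeomorph ι' with hP
  have hPsymm : ContMDiffOn I (IF.prod 𝓘(ℝ, ℝ)) ∞ P.symm P.target := by
    rw [hι'o.toOpenPartialHomeomorph_target, hrange]
    refine hκs.congr ?_
    rintro y hy
    rw [← hrange] at hy
    obtain ⟨q, rfl⟩ := hy
    rw [hι'o.toOpenPartialHomeomorph_left_inv]
    show q = Θ.symm (invFun ι (ι (Θ q)))
    rw [hιinv, Diffeomorph.symm_apply_apply]
  have hemb : Manifold.IsSmoothEmbedding (IF.prod 𝓘(ℝ, ℝ)) I ∞ ι' :=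
    Literature.Topology.FourManifolds.isSmoothEmbedding_of_openPartialHomeomorph P
      (hι'o.toOpenPartialHomeomorph_source ι') (by
        rw [hι'o.toOpenPartialHomeomorph_source]; exact hι's.contMDiffOn) hPsymm
      L
  refine ⟨ι', hemb, hrange, fun t ↦ ?_, fun θ t ht ↦ ?_⟩
  · -- slices are preserved: `Θ` is fibrewise bijective over `ℝ`
    apply Subset.antisymm
    · rintro _ ⟨⟨θ, t'⟩, ⟨-, rfl : t' = t⟩, rfl⟩
      exact ⟨(ν (θ, t'), t'), ⟨mem_univ _, rfl⟩, rfl⟩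
    · rintro _ ⟨⟨θ', t'⟩, ⟨-, rfl : t' = t⟩, rfl⟩
      refine ⟨(om (θ', t'), t'), ⟨mem_univ _, rfl⟩, ?_⟩
      show ι (Θ (om (θ', t'), t')) = ι (θ', t')
      rw [hΘ]
      show ι (ν (om (θ', t'), t'), t') = ι (θ', t')
      rw [hνom]
  · -- below `a` the frozen parameter is `t` itself
    show ι (Θ (θ, t)) = ψ (θ, t + d)
    rw [hΘ]
    show ι (ν (θ, t), t) = ψ (θ, t + d)
    have hlt : lam t = t := hLa t ht
    have := hν_spec θ t
    rw [hlt] at this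
    exact this

end Untwist

end Literature.Geometry.Manifold

end
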